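import Summits.CriticalPhenomena.PercolationContinuityZ3.Theorems.SahiCISPositivity
import Summits.CriticalPhenomena.PercolationContinuityZ3.Theorems.SahiBoxTP2Real

/-!
# CIS laws on `ℝ^d` (a.e.-kernel sense, read through the coordinatewise sigmoid): positive association and Sahi
# positivity for bounded monotone families

Cell `prim-sahi`, typer (generation 17); `--supports stmt-CriticalPhenomena-4575`.  Theorems only (no definitions,
no named facts, no sorries).

Colangelo–Müller–Scarsini's setting is `ℝ^d`.  The coordinatewise sigmoid `ℝ^d → (0,1)^d ⊂ Q_d` is a measurable
order isomorphism onto the open cube (`SahiBoxTP2Real.lean`), so a law `ν` on `ℝ^d` is conditionally increasing in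
sequence (in any of the equivalent version-free senses of `SahiCISCoupling.lean` / `SahiCISCylinderConverse.lean`) iff
its image `ν ∘ sigmoid⁻¹` on `Q_d` is `IsCISae d`.  Under that hypothesis:

* `IsCISae.msahiE_nonneg_real` (`_antitone`) — `E_n(f_0,…,f_{n−1}) ≥ 0` for all BOUNDED measurable nonnegative
  monotone families on `ℝ^d`, given `LiebSahiContinuum d n`; unconditional layers `_of_le_two`, `_of_order_le_two`,
  and **`IsCISae.msahiE_three_nonneg_real`: `E₃ ≥ 0` for every CIS law on `ℝ³`**;
* `IsCISae.isPositivelyAssociated_real` — positive association on `ℝ^d` (Müller–Stoyan Thm. 3.10.11, no density);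
* `IsBoxTP2.isCISae_map_sigmoidPi` — box-TP₂ laws on `ℝ^d` (e.g. MTP₂ densities w.r.t. any product reference
  measure, `IsBoxTP2.withDensity_pi`: Gaussians with `M`-matrix precision, discrete MTP₂ laws on `ℤ^d`) satisfy the
  hypothesis.
Proof: the everywhere-monotone coupling `G` of the image law (`IsCISae.exists_monotone_coupling`) composed with the
coordinatewise logit, which is monotone on the open cube (full image measure).

References: Müller–Stoyan 2002, Thm. 3.10.11 [MullerStoyan2002]; Colangelo–Müller–Scarsini 2006 §4
[ColangeloMullerScarsini2006].  Statements are this work.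
-/

noncomputable section

namespace Summit.CriticalPhenomena.PercolationContinuityZ3.Theorems.SahiCIS

open MeasureTheory ProbabilityTheory Set Filter Topology Function
open Summit.CriticalPhenomena.PercolationContinuityZ3.Theorems.SahiBoxTP2
open Literature.Combinatorics.Sahi2008 Literature.Probability.Percolation
open scoped ENNReal unitInterval

variable {d n : ℕ}

/-- **Box-TP₂ laws on `ℝ^d` are CIS** (their sigmoid image is `IsCISae d`). [this work] -/
theorem _root_.Summit.CriticalPhenomena.PercolationContinuityZ3.Theorems.SahiBoxTP2.IsBoxTP2.isCISae_map_sigmoidPi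
    (ν : Measure (Fin d → ℝ)) [IsProbabilityMeasure ν] (hν : IsBoxTP2 ν) : IsCISae d (ν.map sigmoidPi) := by
  haveI : IsProbabilityMeasure (ν.map sigmoidPi) := Measure.isProbabilityMeasure_map measurable_sigmoidPi.aemeasurable
  exact (hν.map_sigmoidPi).isCISae d _

/-- A CIS law on `ℝ^d` is the image of Lebesgue measure on `Q_d` under `logit ∘ G`, `G` monotone Borel, monotone on a
set of full measure (plumbing shared by the theorems below). [this work] -/
theorem IsCISae.exists_real_coupling (ν : Measure (Fin d → ℝ)) [IsProbabilityMeasure ν]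
    (hν : IsCISae d (ν.map sigmoidPi)) :
    ∃ G : (Fin d → I) → (Fin d → I), ∃ S : Set (Fin d → I), Measurable G ∧
      (∀ᵐ u ∂(volume : Measure (Fin d → I)), u ∈ S) ∧ MonotoneOn (logitPi ∘ G) S ∧
      ν = (volume : Measure (Fin d → I)).map (logitPi ∘ G) := by
  haveI : IsProbabilityMeasure (ν.map sigmoidPi) := Measure.isProbabilityMeasure_map measurable_sigmoidPi.aemeasurable
  obtain ⟨G, hGmono, hGm, hGμ⟩ := hν.exists_monotone_coupling
  have hν' : ν = (volume : Measure (Fin d → I)).map (logitPi ∘ G) := by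
    rw [← Measure.map_map measurable_logitPi hGm, hGμ, Measure.map_map measurable_logitPi measurable_sigmoidPi]
    conv_lhs => rw [← Measure.map_id (μ := ν)]
    congr 1
    funext x
    exact (logitPi_sigmoidPi x).symm
  have hGS : ∀ᵐ u ∂(volume : Measure (Fin d → I)), u ∈ G ⁻¹' openCube d := by
    have h3 := ae_map_sigmoidPi_mem_openCube ν
    rw [← hGμ] at h3
    exact ae_of_ae_map hGm.aemeasurable h3
  refine ⟨G, G ⁻¹' openCube d, hGm, hGS, fun u hu v hv huv => logitPi_monotoneOn hu hv (hGmono huv), hν'⟩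

/-- **Sahi positivity of CIS laws on `ℝ^d`, increasing families**: given `LiebSahiContinuum d n`, every probability
law `ν` on `ℝ^d` whose sigmoid image is `IsCISae d` has `E_n ≥ 0` on bounded measurable nonnegative increasing
families. [this work] -/
theorem IsCISae.msahiE_nonneg_real (h : LiebSahiContinuum d n) (ν : Measure (Fin d → ℝ)) [IsProbabilityMeasure ν]
    (hν : IsCISae d (ν.map sigmoidPi)) (f : Fin n → (Fin d → ℝ) → ℝ) (hfm : ∀ i, Measurable (f i))
    (hf0 : ∀ i x, 0 ≤ f i x) {M : ℝ} (hfM : ∀ i x, f i x ≤ M) (hmono : ∀ i, Monotone (f i)) :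
    0 ≤ msahiE ν n f := by
  obtain ⟨G, S, hGm, hS, hGS, hν'⟩ := IsCISae.exists_real_coupling ν hν
  rw [hν']
  exact msahiE_map_nonneg_of_liebSahiContinuum_of_monotoneOn h (measurable_logitPi.comp hGm) hS hGS f hfm hf0
    (fun _ => M) hfM hmono

/-- **Sahi positivity of CIS laws on `ℝ^d`, decreasing families.** [this work] -/
theorem IsCISae.msahiE_nonneg_real_antitone (h : LiebSahiContinuum d n) (ν : Measure (Fin d → ℝ))
    [IsProbabilityMeasure ν] (hν : IsCISae d (ν.map sigmoidPi)) (f : Fin n → (Fin d → ℝ) → ℝ)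
    (hfm : ∀ i, Measurable (f i)) (hf0 : ∀ i x, 0 ≤ f i x) {M : ℝ} (hfM : ∀ i x, f i x ≤ M)
    (hanti : ∀ i, Antitone (f i)) : 0 ≤ msahiE ν n f := by
  obtain ⟨G, S, hGm, hS, hGS, hν'⟩ := IsCISae.exists_real_coupling ν hν
  rw [hν']
  exact msahiE_map_nonneg_of_liebSahiContinuum_of_monotoneOn_antitone h (measurable_logitPi.comp hGm) hS hGS f hfm
    hf0 (fun _ => M) hfM hanti

/-- UNCONDITIONAL, `d ≤ 2`. [this work] -/
theorem IsCISae.msahiE_nonneg_real_of_le_two (hd : d ≤ 2) (ν : Measure (Fin d → ℝ)) [IsProbabilityMeasure ν]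
    (hν : IsCISae d (ν.map sigmoidPi)) (f : Fin n → (Fin d → ℝ) → ℝ) (hfm : ∀ i, Measurable (f i))
    (hf0 : ∀ i x, 0 ≤ f i x) {M : ℝ} (hfM : ∀ i x, f i x ≤ M) (hmono : ∀ i, Monotone (f i)) :
    0 ≤ msahiE ν n f :=
  hν.msahiE_nonneg_real (liebSahiContinuum_of_le_two hd n) ν f hfm hf0 hfM hmono

/-- UNCONDITIONAL, `n ≤ 2`. [this work] -/
theorem IsCISae.msahiE_nonneg_real_of_order_le_two (hn : n ≤ 2) (ν : Measure (Fin d → ℝ))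
    [IsProbabilityMeasure ν] (hν : IsCISae d (ν.map sigmoidPi)) (f : Fin n → (Fin d → ℝ) → ℝ)
    (hfm : ∀ i, Measurable (f i)) (hf0 : ∀ i x, 0 ≤ f i x) {M : ℝ} (hfM : ∀ i x, f i x ≤ M)
    (hmono : ∀ i, Monotone (f i)) : 0 ≤ msahiE ν n f :=
  hν.msahiE_nonneg_real (liebSahiContinuum_of_order_le_two d hn) ν f hfm hf0 hfM hmono

/-- **UNCONDITIONAL: every CIS law on `ℝ³` satisfies `E₃(f,g,h) ≥ 0`** for bounded measurable nonnegative increasing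
`f, g, h` (kernel-only `[3]³` certificate, standard axioms). [this work] -/
theorem IsCISae.msahiE_three_nonneg_real (ν : Measure (Fin 3 → ℝ)) [IsProbabilityMeasure ν]
    (hν : IsCISae 3 (ν.map sigmoidPi)) (f : Fin 3 → (Fin 3 → ℝ) → ℝ) (hfm : ∀ i, Measurable (f i))
    (hf0 : ∀ i x, 0 ≤ f i x) {M : ℝ} (hfM : ∀ i x, f i x ≤ M) (hmono : ∀ i, Monotone (f i)) :
    0 ≤ msahiE ν 3 f :=
  hν.msahiE_nonneg_real (SahiGridPattern.liebSahiContinuum_of_patternPos fun A B C =>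
    SahiGridPattern.sStarD_three_nonneg A B C) ν f hfm hf0 hfM hmono

/-- **CIS laws on `ℝ^d` are positively associated** (no density; Müller–Stoyan Thm. 3.10.11). [this work] -/
theorem IsCISae.isPositivelyAssociated_real (ν : Measure (Fin d → ℝ)) [IsProbabilityMeasure ν]
    (hν : IsCISae d (ν.map sigmoidPi)) : IsPositivelyAssociated ν := by
  refine isPositivelyAssociated_of_indicator ν fun A B hA hB hAm hBm => ?_
  obtain ⟨hAmo, hAme, hA0, hA1⟩ := indicator_one_props hA hAm
  obtain ⟨hBmo, hBme, hB0, hB1⟩ := indicator_one_props hB hBm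
  have h := hν.msahiE_nonneg_real_of_order_le_two le_rfl ν ![A.indicator 1, B.indicator 1]
    (fun i => by fin_cases i <;> assumption) (fun i => by fin_cases i <;> assumption) (M := 1)
    (fun i => by fin_cases i <;> assumption) (fun i => by fin_cases i <;> assumption)
  rw [msahiE_two] at h
  linarith

end Summit.CriticalPhenomena.PercolationContinuityZ3.Theorems.SahiCIS

end
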